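import Summits.CriticalPhenomena.PercolationContinuityZ3.Theorems.Transplant.KNLevelsStepIII
import Summits.CriticalPhenomena.PercolationContinuityZ3.Theorems.Transplant.KNLevelsStepIV
import Summits.CriticalPhenomena.PercolationContinuityZ3.Theorems.Transplant.KNLevelsHittable
import HarnessLib

/-!
# F6 (generic), part 3 — Kozma–Nitzan Lemma 10, STEP V over the levels of any locally finite graph: Conjecture 3 in the pinned
# weightings (BLUEPRINT-I-PHI §3 Φ7; generalises `L/KozmaNitzanTargetLemma.lean` ll. 1662–1913 from `zdGraph d` to a graph `G` with levels)

builds on p205010 (kernel theorem, internal audit signed; external expert review pending) — nothing in this file uses p205010.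
Lane `prim-bschramm`, seat `prim-bschramm-p2` (task F6 = Target Lemma Steps III–V); helper file (`--supports stmt-CriticalPhenomena-4575`),
typed against p3's `KNLevelsDefs`/`KNLevelsLocality`/`KNLevelsStepIV` (`LData`, `LHyp`, `Fail`, `GoodVertex`), stmt's `KNLevelsHittable`
(`FinSupp.pinW`) and this seat's `KNLevelsStepIII` (seed data `SData`, axioms `SHyp`, the events `Fx`, `Gev`).

Kozma–Nitzan's Step V (arXiv:2401.12397 §4 pp. 21–22): average the Step-IV face estimate over the first-seed decomposition `𝒢 = ⋃ F_x`
((26) ⟹ `Σ_ξ p_ξ φ_ξ > (1-3δ)²`), discard the patterns `ξ` of the shell pairs with `φ_ξ ≤ 1 - δ_{C3}` (mass `≤ ε/2`), apply the gluing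
hypothesis (Conjecture 3) in each remaining pinned weighting `K_ξ` — source `o`, relays `A_ξ`, target `T` — and sum.  The argument is
graph-free given: the seed estimate (19) and the `F_x`-algebra of Step III (now over the abstract seed data `σ`), the face estimate of
Step IV for every candidate contact, and two facts about the shell `S`: `S ⊆ B⟨j⟩` and no seed edge is a pair inside `S` (KN: `S =
B⟨j-1⟩ \ B⟨j-2M-2⟩`, the seeds live in `B⟨j⟩ \ B⟨j-1⟩` plus one edge into `S`), so that `P_{K_ξ}(F_x) = P(F_x)`.

* `LHyp.stepV_in` — with the relays reliable to `T` INSIDE a region `Rg` (KN's `D ∌ o`; the gluing hypothesis is then only needed for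
  `Rg`-reliable relays, cf. `KozmaNitzan.targetLemma_avoiding`);
* `LHyp.stepV` — the printed form (`Rg = univ`, relays `GoodVertex`).
Proofs: the original's, line by line.

[cite: KozmaNitzan2024, §4 Lemma 10, pp. 21–22 (Step V, (26) and the patterns ξ ∈ W) — the ℤ^d model] [cite: GrimmettPercolation1999, §7.2]
-/

noncomputable section

open MeasureTheory ProbabilityTheory
open scoped ENNReal

namespace Summit.CriticalPhenomena.PercolationContinuityZ3.Theorems

namespace Transplant

namespace KNLevels

open Literature.Probability.Percolation Literature.Probability.LatticeModels SimpleGraph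

variable {V : Type*} [DecidableEq V] {G : SimpleGraph V} [G.LocallyFinite]

namespace LHyp

variable {L : LData G} {W : Sym2 V → unitInterval} {p : unitInterval} {D : Finset V} {R : ℕ}
variable (hL : LHyp L W p D R)
include hL

open Classical in
/-- **Step V with region-internal relay reliability** (KN pp. 21–22, over the levels of `G`): the averaged estimate (26) ⟹
`Σ_ξ p_ξ φ_ξ > (1-3δ)²`, the set of good patterns, the gluing hypothesis in each `K_ξ`, and the final summation — with the relay set
`A_ξ := {u ∈ S : P(u ↔ T inside Rg | ξ) > 1 - δ}` for an arbitrary region `Rg`, so that the gluing hypothesis `hC3` is only needed for relays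
reliable to `T` INSIDE `Rg` (for `Rg = D ∌ o`: by paths avoiding the source).  Inputs: a level `j ≤ R` with `≥ N` contacts w.h.p. (Step II),
seed data `σ` satisfying the Step-III axioms with `(1 - p^{sB})^k ≤ δ`, a shell `S ⊆ B⟨j⟩ ∩ D` containing every face and avoided by every
seed, the face estimate of `stepIV_in` for every candidate contact, and the gluing hypothesis for finitely supported weightings with source
`o`, target `T` and `Rg`-reliable relays. [cite: KozmaNitzan2024, §4 pp. 21–22 (Step V)] -/
theorem stepV_in [Countable V] {σ : SData V} {j : ℕ} (hσ : SHyp L j σ) (hj : j ≤ R) {Rg : Set V}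
    {S T : Finset V} (hSX : S ⊆ L.X j) (hSD : S ⊆ D)
    (hSseed : ∀ x ∈ σ.K, ∀ e ∈ σ.seed x, e ∉ wireSet (↑S : Set V))
    {ε δ δc : ℝ} (hε : 0 < ε) (hε1 : ε ≤ 1) (hδ : 0 < δ) (hδc : δ ≤ δc)
    (h3δ : 3 * δ ≤ 1) (h12 : 12 * δ ≤ ε * δc)
    (hII : 1 - 2 * δ < (prodBernoulli W).real (L.Fail σ.N j)ᶜ)
    (hIII : (1 - (p : ℝ) ^ σ.sB) ^ σ.k ≤ δ)
    (hUS : ∀ x ∈ σ.K, σ.face x ⊆ S)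
    (hIV : ∀ x ∈ σ.K,
      1 - 3 * δ ≤ (prodBernoulli W).real {ω | ∃ u ∈ σ.face x,
        1 - δ < (prodBernoulli (pinW W (wireSet (↑S : Set V)) ω)).real (⋃ t ∈ T, openConnIn Rg u t)})
    (hC3 : ∀ (w : Sym2 V → unitInterval), FinSupp w L.Sfin → ∀ (A : Finset V), A ⊆ L.Sfin →
      1 - δc < (prodBernoulli w).real (⋃ a ∈ A, openConn L.o a) →
      (∀ a ∈ A, 1 - δc < (prodBernoulli w).real (⋃ t ∈ T, openConnIn Rg a t)) →
      1 - ε / 2 < (prodBernoulli w).real (⋃ t ∈ T, openConn L.o t)) :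
    1 - ε < (prodBernoulli W).real (⋃ t ∈ T, openConn L.o t) := by
  set μ := prodBernoulli W with hμ
  set OB := σ.K with hOB
  set F := pairsF S with hF
  have hFS : (↑F : Set (Sym2 V)) = wireSet (↑S : Set V) := coe_pairsF S
  have hSfin : S ⊆ L.Sfin := hSD.trans hL.DS
  -- the good sets `A_ξ` and the quantities `φ_ξ`
  set Aof : Finset (Sym2 V) → Finset V := fun P => S.filter fun u =>
    1 - δ < (prodBernoulli (pinW W (wireSet (↑S : Set V)) ↑P)).real (⋃ t ∈ T, openConnIn Rg u t) with hAof
  set φ : Finset (Sym2 V) → ℝ := fun P =>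
    (prodBernoulli (pinW W ↑F ↑P)).real (⋃ a ∈ Aof P, openConn L.o a) with hφ
  set cyl : Finset (Sym2 V) → Set (BondConfig V) := fun P => localCylinder ↑F ↑P with hcyl
  -- `μ(𝒢) > 1 - 3δ`
  have hG : 1 - 3 * δ < μ.real (L.Gev σ j) := by
    have hmG : MeasurableSet (L.Gev σ j) := LData.measurableSet_Gev j
    have h1 := hL.real_manyContacts_diff_Gev_le hσ hj
    have h2 : μ.real (L.Fail σ.N j)ᶜ ≤ μ.real ((L.Fail σ.N j)ᶜ \ L.Gev σ j) + μ.real (L.Gev σ j) := by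
      rw [← measureReal_inter_add_sdiff (s := (L.Fail σ.N j)ᶜ) hmG, add_comm]
      exact add_le_add le_rfl (measureReal_mono Set.inter_subset_right)
    linarith
  -- Claim D: `Σ_P μ(cyl P) φ(P) ≥ (1 - 3δ) μ(𝒢)`
  have hGood_det : ∀ x, DeterminedBy {ω | ∃ u ∈ σ.face x,
      1 - δ < (prodBernoulli (pinW W (wireSet (↑S : Set V)) ω)).real (⋃ t ∈ T, openConnIn Rg u t)} ↑F := by
    intro x
    rw [determinedBy_iff]
    intro ω ω' hω
    simp only [Set.mem_setOf_eq]
    have hag : ∀ e ∈ wireSet (↑S : Set V), e ∈ ω ↔ e ∈ ω' := by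
      intro e he
      rw [← hFS] at he
      have := Set.ext_iff.1 hω e
      simp only [Set.mem_inter_iff] at this
      exact ⟨fun h' => (this.1 ⟨h', he⟩).1, fun h' => (this.2 ⟨h', he⟩).1⟩
    refine exists_congr fun u => and_congr_right fun _ => ?_
    rw [pinW_congr W hag]
  have hFx_pin : ∀ P, ∀ x ∈ OB, (prodBernoulli (pinW W ↑F ↑P)).real (L.Fx σ j x) = μ.real (L.Fx σ j x) := by
    intro P x hx
    rw [hμ]
    refine (prodBernoulli_real_eq_of_determinedBy W _ (F := (↑F : Set (Sym2 V))ᶜ)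
      (fun e he => (pinW_apply_of_not_mem W ↑P he).symm) ?_ (LData.measurableSet_Fx j x)).symm
    rw [hFS]
    exact LData.determinedBy_Fx hSX hSseed hx
  have hφ_ge : ∀ P, P ⊆ F →
      ∑ x ∈ OB.filter (fun x => ∃ u ∈ σ.face x, u ∈ Aof P), μ.real (L.Fx σ j x) ≤ φ P := by
    intro P hP
    have hsub : (⋃ x ∈ OB.filter (fun x => ∃ u ∈ σ.face x, u ∈ Aof P), L.Fx σ j x) ⊆
        ⋃ a ∈ Aof P, openConn L.o a := by
      intro ω hω
      simp only [Set.mem_iUnion, exists_prop, Finset.mem_filter] at hω ⊢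
      obtain ⟨x, ⟨-, u, hu, huA⟩, hFx⟩ := hω
      exact ⟨u, huA, LData.openConn_of_mem_oSeed hσ (LData.Fx_subset_oSeed x hFx) hu⟩
    calc _ = ∑ x ∈ OB.filter (fun x => ∃ u ∈ σ.face x, u ∈ Aof P),
            (prodBernoulli (pinW W ↑F ↑P)).real (L.Fx σ j x) :=
          Finset.sum_congr rfl fun x hx => (hFx_pin P x (Finset.mem_filter.1 hx).1).symm
      _ = (prodBernoulli (pinW W ↑F ↑P)).real
            (⋃ x ∈ OB.filter (fun x => ∃ u ∈ σ.face x, u ∈ Aof P), L.Fx σ j x) := by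
          rw [measureReal_biUnion_finset]
          · intro x hx x' hx' hne
            exact LData.Fx_disjoint hne (Finset.mem_filter.1 hx').1 (Finset.mem_filter.1 hx).1
          · intro x _; exact LData.measurableSet_Fx j x
      _ ≤ φ P := measureReal_mono hsub (measure_ne_top _ _)
  have hD : (1 - 3 * δ) * μ.real (L.Gev σ j) ≤ ∑ P ∈ F.powerset, μ.real (cyl P) * φ P := by
    -- `Σ_x μ(F_x) μ(Good_x) = Σ_P μ(cyl P) Σ_{x good for P} μ(F_x)`
    have hGx : ∀ x ∈ OB, μ.real {ω | ∃ u ∈ σ.face x,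
        1 - δ < (prodBernoulli (pinW W (wireSet (↑S : Set V)) ω)).real (⋃ t ∈ T, openConnIn Rg u t)} =
        ∑ P ∈ F.powerset.filter (fun P => ∃ u ∈ σ.face x, u ∈ Aof P), μ.real (cyl P) := by
      intro x hx
      rw [hμ, prodBernoulli_real_eq_sum_localCylinder W F (hGood_det x)]
      refine Finset.sum_congr ?_ fun P _ => rfl
      ext P
      simp only [Finset.mem_filter, Finset.mem_powerset, Set.mem_setOf_eq, hAof, and_congr_right_iff]
      intro _
      constructor
      · rintro ⟨u, hu, hg⟩; exact ⟨u, hu, hUS x hx hu, hg⟩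
      · rintro ⟨u, hu, -, hg⟩; exact ⟨u, hu, hg⟩
    calc (1 - 3 * δ) * μ.real (L.Gev σ j)
        = ∑ x ∈ OB, (1 - 3 * δ) * μ.real (L.Fx σ j x) := by
          rw [← LData.biUnion_Fx_eq_Gev, measureReal_biUnion_finset, Finset.mul_sum]
          · intro x hx x' hx' hne; exact LData.Fx_disjoint hne hx' hx
          · intro x _; exact LData.measurableSet_Fx j x
      _ ≤ ∑ x ∈ OB, μ.real {ω | ∃ u ∈ σ.face x,
            1 - δ < (prodBernoulli (pinW W (wireSet (↑S : Set V)) ω)).real (⋃ t ∈ T, openConnIn Rg u t)} *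
            μ.real (L.Fx σ j x) :=
          Finset.sum_le_sum fun x hx => mul_le_mul_of_nonneg_right (hIV x hx) measureReal_nonneg
      _ = ∑ x ∈ OB, ∑ P ∈ F.powerset.filter (fun P => ∃ u ∈ σ.face x, u ∈ Aof P),
            μ.real (cyl P) * μ.real (L.Fx σ j x) := by
          refine Finset.sum_congr rfl fun x hx => ?_
          rw [hGx x hx, Finset.sum_mul]
      _ = ∑ P ∈ F.powerset, ∑ x ∈ OB.filter (fun x => ∃ u ∈ σ.face x, u ∈ Aof P),
            μ.real (cyl P) * μ.real (L.Fx σ j x) := by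
          rw [Finset.sum_comm' (t' := F.powerset)
            (s' := fun P => OB.filter (fun x => ∃ u ∈ σ.face x, u ∈ Aof P))]
          intro x P
          simp only [Finset.mem_filter, Finset.mem_powerset]
          tauto
      _ = ∑ P ∈ F.powerset, μ.real (cyl P) *
            ∑ x ∈ OB.filter (fun x => ∃ u ∈ σ.face x, u ∈ Aof P), μ.real (L.Fx σ j x) := by
          refine Finset.sum_congr rfl fun P _ => ?_
          rw [Finset.mul_sum]
      _ ≤ ∑ P ∈ F.powerset, μ.real (cyl P) * φ P :=
          Finset.sum_le_sum fun P hP => mul_le_mul_of_nonneg_left (hφ_ge P (Finset.mem_powerset.1 hP)) measureReal_nonneg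
  -- total mass of the cylinders is `1`
  have hcyl_sum : ∑ P ∈ F.powerset, μ.real (cyl P) = 1 := by
    have := prodBernoulli_real_eq_sum_localCylinder W F (determinedBy_univ (↑F : Set (Sym2 V)))
    rw [probReal_univ] at this
    rw [hμ, this]
    refine (Finset.sum_congr ?_ fun P _ => rfl)
    ext P; simp
  -- Claim E: the bad patterns have mass `≤ ε/2`
  set Bad := F.powerset.filter (fun P => φ P ≤ 1 - δc) with hBad
  have hφ_le : ∀ P, φ P ≤ 1 := fun P => measureReal_le_one
  have hE : ∑ P ∈ Bad, μ.real (cyl P) ≤ ε / 2 := by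
    have hδc0 : 0 < δc := hδ.trans_le hδc
    have h1 : δc * ∑ P ∈ Bad, μ.real (cyl P) ≤ ∑ P ∈ F.powerset, μ.real (cyl P) * (1 - φ P) := by
      rw [Finset.mul_sum]
      calc ∑ P ∈ Bad, δc * μ.real (cyl P) ≤ ∑ P ∈ Bad, μ.real (cyl P) * (1 - φ P) :=
            Finset.sum_le_sum fun P hP => by
              rw [mul_comm]
              exact mul_le_mul_of_nonneg_left (by have := (Finset.mem_filter.1 hP).2; linarith) measureReal_nonneg
        _ ≤ ∑ P ∈ F.powerset, μ.real (cyl P) * (1 - φ P) :=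
            Finset.sum_le_sum_of_subset_of_nonneg (Finset.filter_subset _ _) fun P _ _ =>
              mul_nonneg measureReal_nonneg (by linarith [hφ_le P])
    have h2 : ∑ P ∈ F.powerset, μ.real (cyl P) * (1 - φ P) =
        1 - ∑ P ∈ F.powerset, μ.real (cyl P) * φ P := by
      simp only [mul_sub, mul_one, Finset.sum_sub_distrib, hcyl_sum]
    have h3 : 1 - ∑ P ∈ F.powerset, μ.real (cyl P) * φ P < 6 * δ := by
      have : (1 - 3 * δ) * (1 - 3 * δ) < (1 - 3 * δ) * μ.real (L.Gev σ j) ∨ 1 - 3 * δ = 0 := by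
        rcases eq_or_lt_of_le (sub_nonneg.2 h3δ) with h0 | h0
        · exact Or.inr h0.symm
        · exact Or.inl (mul_lt_mul_of_pos_left hG h0)
      rcases this with h4 | h4
      · nlinarith
      · have : ∑ P ∈ F.powerset, μ.real (cyl P) * φ P ≥ 0 :=
          Finset.sum_nonneg fun P _ => mul_nonneg measureReal_nonneg measureReal_nonneg
        nlinarith
    have h4 : δc * ∑ P ∈ Bad, μ.real (cyl P) ≤ 6 * δ := by linarith
    have h5 : δc * ∑ P ∈ Bad, μ.real (cyl P) ≤ δc * (ε / 2) := by nlinarith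
    exact le_of_mul_le_mul_left h5 hδc0
  -- Claim F: on good patterns the gluing hypothesis applies
  have hF : ∀ P ∈ F.powerset, P ∉ Bad →
      1 - ε / 2 < (prodBernoulli (pinW W ↑F ↑P)).real (⋃ t ∈ T, openConn L.o t) := by
    intro P hP hPB
    have hgood : 1 - δc < φ P := by
      by_contra hle; exact hPB (Finset.mem_filter.2 ⟨hP, not_lt.1 hle⟩)
    have hsupp : FinSupp (pinW W ↑F ↑P) L.Sfin :=
      hL.fin.pinW (F := (↑F : Set (Sym2 V))) ↑P
        (by rw [hFS]; exact KozmaNitzan.wireSet_mono (Finset.coe_subset.2 hSfin))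
    refine hC3 _ hsupp (Aof P) ((Finset.filter_subset _ _).trans hSfin) hgood fun a ha => ?_
    have hga := (Finset.mem_filter.1 ha).2
    rw [← hFS] at hga
    linarith
  -- conclusion: total probability over the patterns
  have hmT : MeasurableSet (⋃ t ∈ T, openConn L.o t : Set (BondConfig V)) :=
    Finset.measurableSet_biUnion _ fun t _ => measurableSet_openConn_holds _ _
  have htot := prodBernoulli_real_inter_eq_sum_pinW W F hmT (determinedBy_univ (↑F : Set (Sym2 V)))
  rw [Set.inter_univ] at htot
  simp only [Set.mem_univ, Finset.filter_true] at htot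
  rw [hμ] at hE hcyl_sum
  rw [htot]
  calc 1 - ε < (1 - ε / 2) * (1 - ε / 2) := by nlinarith
    _ ≤ (1 - ε / 2) * ∑ P ∈ F.powerset \ Bad, (prodBernoulli W).real (cyl P) := by
        have hnonneg : (0 : ℝ) ≤ 1 - ε / 2 := by linarith
        have : ∑ P ∈ F.powerset \ Bad, (prodBernoulli W).real (cyl P) =
            1 - ∑ P ∈ Bad, (prodBernoulli W).real (cyl P) := by
          have hBsub : Bad ⊆ F.powerset := by rw [hBad]; exact Finset.filter_subset _ _
          rw [← hcyl_sum, ← Finset.sum_sdiff hBsub]; ring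
        rw [this]
        exact mul_le_mul_of_nonneg_left (by linarith) hnonneg
    _ = ∑ P ∈ F.powerset \ Bad, (prodBernoulli W).real (cyl P) * (1 - ε / 2) := by
        rw [Finset.mul_sum]; refine Finset.sum_congr rfl fun P _ => mul_comm _ _
    _ ≤ ∑ P ∈ F.powerset \ Bad, (prodBernoulli W).real (cyl P) *
          (prodBernoulli (pinW W ↑F ↑P)).real (⋃ t ∈ T, openConn L.o t) :=
        Finset.sum_le_sum fun P hP => by
          obtain ⟨hP1, hP2⟩ := Finset.mem_sdiff.1 hP
          exact mul_le_mul_of_nonneg_left (hF P hP1 hP2).le measureReal_nonneg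
    _ ≤ ∑ P ∈ F.powerset, (prodBernoulli W).real (cyl P) *
          (prodBernoulli (pinW W ↑F ↑P)).real (⋃ t ∈ T, openConn L.o t) :=
        Finset.sum_le_sum_of_subset_of_nonneg Finset.sdiff_subset fun P _ _ =>
          mul_nonneg measureReal_nonneg measureReal_nonneg

open Classical in
/-- **Step V** (KN pp. 21–22, over the levels of `G`): the averaged estimate (26) ⟹ `Σ_ξ p_ξ φ_ξ > (1-3δ)²`, the set of good patterns,
the gluing hypothesis (Conjecture 3 for finitely supported weightings with a target set) in each `K_ξ`, and the final summation.  Inputs: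
a level `j` with many contacts w.h.p. (Step II), the seed bound (19) (Step III), the face estimate (24)–(25) for every candidate contact
(Step IV), and Conjecture 3. [cite: KozmaNitzan2024, §4 pp. 21–22 (Step V)] -/
theorem stepV [Countable V] {σ : SData V} {j : ℕ} (hσ : SHyp L j σ) (hj : j ≤ R)
    {S T : Finset V} (hSX : S ⊆ L.X j) (hSD : S ⊆ D)
    (hSseed : ∀ x ∈ σ.K, ∀ e ∈ σ.seed x, e ∉ wireSet (↑S : Set V))
    (hTD : T ⊆ D) (hTne : T.Nonempty) {ε δ δc : ℝ} (hε : 0 < ε) (hε1 : ε ≤ 1) (hδ : 0 < δ) (hδc : δ ≤ δc)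
    (h3δ : 3 * δ ≤ 1) (h12 : 12 * δ ≤ ε * δc)
    (hII : 1 - 2 * δ < (prodBernoulli W).real (L.Fail σ.N j)ᶜ)
    (hIII : (1 - (p : ℝ) ^ σ.sB) ^ σ.k ≤ δ)
    (hUS : ∀ x ∈ σ.K, σ.face x ⊆ S)
    (hIV : ∀ x ∈ σ.K,
      1 - 3 * δ ≤ (prodBernoulli W).real {ω | ∃ u ∈ σ.face x, GoodVertex W S T δ ω u})
    (hC3 : ∀ (w : Sym2 V → unitInterval), FinSupp w L.Sfin → ∀ (A T' : Finset V) (o' : V),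
      A ⊆ L.Sfin → T' ⊆ L.Sfin → o' ∈ L.Sfin → T'.Nonempty →
      1 - δc < (prodBernoulli w).real (⋃ a ∈ A, openConn o' a) →
      (∀ a ∈ A, 1 - δc < (prodBernoulli w).real (⋃ t ∈ T', openConn a t)) →
      1 - ε / 2 < (prodBernoulli w).real (⋃ t ∈ T', openConn o' t)) :
    1 - ε < (prodBernoulli W).real (⋃ t ∈ T, openConn L.o t) := by
  refine hL.stepV_in (Rg := Set.univ) hσ hj hSX hSD hSseed hε hε1 hδ hδc h3δ h12 hII hIII hUS
    (fun x hx => ?_) (fun w hw A hA hoA haT => ?_)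
  · simpa only [GoodVertex, KozmaNitzan.openConnIn_univ_eq'] using hIV x hx
  · exact hC3 w hw A T L.o hA (hTD.trans hL.DS) hL.o_mem hTne hoA
      (fun a ha => by simpa only [KozmaNitzan.openConnIn_univ_eq'] using haT a ha)

end LHyp

omit [DecidableEq V] in
/-- A seed edge with an endpoint off `S` is not a pair inside `S` (the form in which instances discharge `hSseed`). [folklore] -/
theorem not_mem_wireSet_of_exists_not_mem {S : Finset V} {e : Sym2 V} (h : ∃ z ∈ e, z ∉ S) :
    e ∉ wireSet (↑S : Set V) := by
  obtain ⟨z, hz, hzS⟩ := h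
  exact fun he => hzS (Finset.mem_coe.1 (he.1 z hz))

end KNLevels

end Transplant

end Summit.CriticalPhenomena.PercolationContinuityZ3.Theorems

end
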